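import Mathlib
import Literature.NumberTheory.LFunctions.Zhang2022.Section12U024Mellin
import Literature.NumberTheory.LFunctions.Zhang2022.Section7XiZeroShortInterval
import Literature.NumberTheory.LFunctions.Zhang2022.ToolkitGaussUnsmoothing
import Literature.NumberTheory.LFunctions.Zhang2022.Section12Ded1217Sizes
import HarnessLib

/-!
# Zhang (2022) §12 p. 69, step u024: the `g`-unsmoothing of the window sum — `U024` in relative form

Topic `Literature/NumberTheory/LFunctions/Zhang2022` (Landau–Siegel audit tree; verdict-neutral).
Y. Zhang, *Discrete mean estimates and the Landau–Siegel zero*, arXiv:2211.02515v1 (2022)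
[Zhang2022LandauSiegel], §12 proof of Lemma 12.2, p. 69, tex L3528 — **an unrefereed manuscript
under adjudication; nothing here asserts or denies its Theorems 1–2.**

DAG node `Z22:§12.u024` (typed CLAIM `Typed.Sec12B.U024`, GAP rows G-L3t5-2, G-L3t5-3; lane ZHANG-L,
WP12-PLAN helper H1 under leaf h1212): "Suppose `dr ≤ P″₁/T`. By (4) and (4) [sic, = (4.2)–(4.3)],
for `|w| = α`: `Σ_{P″₁/dr<l<P″₂/dr} χ(l)ξ_j(l;d,r)/l^{1−β₆+w} = Σ_l χ(l)ξ_j(l;d,r)/l^{1−β₆+w}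
{g(P″₂/(drl)) − g(P″₁/(drl))} + O(𝓛⁻¹⁵) = (2πi)⁻¹∫_{(1)} … + O(𝓛⁻¹⁵)`". The second equality is
exact (`Typed.Sec12B.gSeries_eq_lineInt024`, file `Section12U024Mellin`). THIS FILE proves the first,
in the RELATIVE form the method of absolute values yields:

* `norm_innerSum_sub_gSeries_le` — for every `c′` there is `C` such that for all large `D`, all
  `χ`, `j`, `d, r ≥ 1` with `dr ≤ P″₁/T` and `|w| = α`:
  `‖innerSum − gSeries‖ ≤ C·𝓛⁻¹⁵·(r/φ(r))`.
  Route: the two sharp cut-offs at `X₁ = P″₁/dr`, `X₂ = P″₂/dr` (`≥ T`) are unsmoothed by the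
  tree's `GaussWeight.norm_sum_Ico_sub_tsum_mul_gWeight_le_of_shortInterval` (ToolkitGaussUnsmoothing,
  "by (4.2)–(4.3)" summed over the Gaussian transition windows of logarithmic width `𝓛⁻¹⁵`) for the
  coefficients `b(l) = χ(l)ξ₀ⱼ(l;d,r)l^{β₆−w}·1[l ≤ N₀]`, `N₀ = ⌈X₂²⌉`, whose majorant
  `N₀^{α}·‖ξ₀ⱼ(l;d,r)‖·1[l ≤ N₀]` has the short-interval bound WITHOUT LOGARITHMIC LOSS
  `XiZeroMajorant.xiZero_shortInterval_Ioc` (Shiu at effective exponent `1`, file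
  `Section7XiZeroShortInterval`); the terms `l > N₀` are a Gaussian tail `≤ 2A/N₀`, the possible
  boundary term `l = X₁ ∈ ℕ` is `≤ A′X₁^{−1/2}`, and for `D` large `N₀^α ≤ e^{3π}`,
  `e^{7B log(4N₀)} ≤ e^{189π}` (`B ≤ 9π𝓛⁻⁹`).
* `u024Rel` — both approximations of u024 with the common error `C·𝓛⁻¹⁵·(r/φ(r))`, in the
  `ForAllLarge` shape of the typed node (no Assumption (A) is needed, and every `j` is allowed).

WHY NOT THE TYPED `U024` (uniform `C`): at the primes `p ∣ r` one has `ξ₀ⱼ(p;d,r) = κ(p)` of modulus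
`≈ 2` (App. A Case 2), so the absolute mean over the transition window genuinely carries
`exp(Σ_{p∣r} 1/p) ≍ r/φ(r)`; a `(d,r)`-uniform constant is not reachable by majorants (WP12-PLAN §4e
anticipates the relative reading; the weight `r/φ(r)` is absorbed downstream by the `(8.10)`-type
mass bounds `Skeleton.sum_ratio_pow_div_le(_window)`).

0 new definitions; standard axioms.

## References

* Y. Zhang, arXiv:2211.02515v1 (2022), §12 p. 69 (tex L3528); §4 (4.1)–(4.3) p. 8; §7 p. 33.
  [cite: Zhang2022LandauSiegel, §12 p. 69; §4 (4.2)–(4.3)]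
* P. Shiu, J. reine angew. Math. 313 (1980) 161–170, Theorem 1. [cite: Shiu1980, Theorem 1]
-/

noncomputable section

open Complex Real Filter

namespace Literature.NumberTheory.LFunctions.Zhang2022.Typed.Sec12B

open Literature.NumberTheory.LFunctions.Zhang2022.Skeleton
open Literature.NumberTheory.LFunctions.Zhang2022.GaussWeight
open Literature.NumberTheory.LFunctions.Zhang2022.XiZeroMajorant
open Literature.NumberTheory.Sieve

/-! ### Elementary preliminaries -/

/-- For every `K` one has `K·𝓛³⁰ ≤ D` for all large `D` (`𝓛 = log D`; `(log x)³⁰/x → 0`).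
[folklore] -/
private theorem eventually_mul_ell_pow_le (K : ℝ) : ∀ᶠ D : ℕ in atTop, K * ell D ^ 30 ≤ (D : ℝ) := by
  rcases le_or_gt K 0 with hK | hK
  · refine Filter.Eventually.of_forall fun D => ?_
    have h30 : 0 ≤ ell D ^ 30 := by positivity
    nlinarith [Nat.cast_nonneg (α := ℝ) D]
  · have h := Real.tendsto_pow_log_div_mul_add_atTop 1 0 30 one_ne_zero
    have h2 : ∀ᶠ x : ℝ in atTop, Real.log x ^ 30 / (1 * x + 0) < 1 / K :=
      h.eventually (Iio_mem_nhds (by positivity))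
    have h3 := tendsto_natCast_atTop_atTop.eventually h2
    filter_upwards [h3, eventually_gt_atTop 0] with D hD hD0
    have hD0' : (0 : ℝ) < D := by exact_mod_cast hD0
    rw [one_mul, add_zero, div_lt_div_iff₀ hD0' hK] at hD
    rw [ell]; linarith

/-- `a·l^{1−s}/l = a/l^s` for `l ≥ 1`. [folklore] -/
private theorem mul_cpow_one_sub_div (a s : ℂ) {l : ℕ} (hl : l ≠ 0) :
    a * (l : ℂ) ^ (1 - s) / (l : ℂ) = a / (l : ℂ) ^ s := by
  have hl0 : (l : ℂ) ≠ 0 := by exact_mod_cast hl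
  have hls : (l : ℂ) ^ s ≠ 0 := by
    rw [Ne, Complex.cpow_eq_zero_iff, not_and_or]; exact Or.inl hl0
  rw [Complex.cpow_sub _ _ hl0, Complex.cpow_one]
  field_simp

/-- `exp(−Λ log²l/4) ≤ l⁻⁴` once `Λ ≥ 16` and `log l ≥ 1`. [folklore] -/
private theorem exp_neg_mul_log_sq_le {Λ : ℝ} (hΛ : 16 ≤ Λ) {l : ℝ} (hl : 0 < l) (hlog : 1 ≤ Real.log l) :
    Real.exp (-Λ * Real.log l ^ 2 / 4) ≤ l ^ (-(4 : ℝ)) := by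
  rw [Real.rpow_def_of_pos hl, Real.exp_le_exp]
  nlinarith

/-- `Σ_n 1/n² ≤ 2` (`= π²/6`). [folklore] -/
private theorem tsum_one_div_nat_sq_le_two : ∑' n : ℕ, (1 : ℝ) / (n : ℝ) ^ 2 ≤ 2 := by
  rw [hasSum_zeta_two.tsum_eq]
  have := Real.pi_lt_d2
  nlinarith [Real.pi_pos]

/-- `log(4⌈X²⌉) ≤ 3𝓛⁹` for `1 ≤ X ≤ P = e^{𝓛⁹}`, `𝓛 ≥ 3` (`⌈X²⌉ ≤ 2X² ≤ 2P²`, `log 8 ≤ 3`).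
[cite: Zhang2022LandauSiegel, §2 (2.6)] -/
private theorem log_four_ceil_sq_le {D : ℕ} (hℓ : 3 ≤ ell D) {X : ℝ} (hX1 : 1 ≤ X) (hXP : X ≤ bigP D) :
    Real.log (4 * (⌈X ^ 2⌉₊ : ℝ)) ≤ 3 * ell D ^ 9 := by
  have hX0 : 0 < X := by linarith
  have hP : Real.log (bigP D) = ell D ^ 9 := by rw [bigP, Real.log_exp]
  have hceil : (⌈X ^ 2⌉₊ : ℝ) ≤ 2 * X ^ 2 := by
    have h1 : (⌈X ^ 2⌉₊ : ℝ) < X ^ 2 + 1 := Nat.ceil_lt_add_one (by positivity)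
    nlinarith
  have h8 : Real.log 8 ≤ 3 := by
    have : (8 : ℝ) ≤ Real.exp 3 := by
      have h2 : (2 : ℝ) ≤ Real.exp 1 := by have := Real.exp_one_gt_d9; linarith
      have h3 : Real.exp 3 = Real.exp 1 ^ 3 := by rw [← Real.exp_nat_mul]; norm_num
      rw [h3]
      calc (8 : ℝ) = 2 ^ 3 := by norm_num
        _ ≤ Real.exp 1 ^ 3 := pow_le_pow_left₀ (by norm_num) h2 3
    calc Real.log 8 ≤ Real.log (Real.exp 3) := Real.log_le_log (by norm_num) this
      _ = 3 := Real.log_exp 3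
  have hℓ9 : 3 ≤ ell D ^ 9 := le_trans hℓ (le_self_pow₀ (by linarith) (by norm_num))
  have hP0 : 0 < bigP D := Real.exp_pos _
  have hc0 : (0 : ℝ) < (⌈X ^ 2⌉₊ : ℝ) := by exact_mod_cast Nat.ceil_pos.mpr (by positivity)
  calc Real.log (4 * (⌈X ^ 2⌉₊ : ℝ)) ≤ Real.log (8 * bigP D ^ 2) := by
        refine Real.log_le_log (by linarith) ?_
        nlinarith [mul_le_mul hXP hXP hX0.le (le_trans hX0.le hXP)]
    _ = Real.log 8 + 2 * ell D ^ 9 := by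
        rw [Real.log_mul (by norm_num) (pow_pos hP0 2).ne', Real.log_pow, hP]; ring
    _ ≤ 3 * ell D ^ 9 := by linarith

/-! ### The sizes of the §12 parameters for large `D` -/

/-- For `c′`, `K` given: for all large `D`, `𝓛 ≥ 3`, `B ≤ 9π𝓛⁻⁹`, `K𝓛³⁰ ≤ D ≤ T` and `P″₂ ≤ P`.
[cite: Zhang2022LandauSiegel, §2 (2.6)–(2.13); §6 p. 12] -/
private theorem sizes_eventually (c' K : ℝ) : ∃ D₀ : ℕ, ∀ D : ℕ, D₀ ≤ D →
    3 ≤ ell D ∧ Bsum c' D ≤ 9 * π / ell D ^ 9 ∧ K * ell D ^ 30 ≤ (D : ℝ) ∧ (D : ℝ) ≤ bigT D ∧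
      P2pp D ≤ bigP D := by
  obtain ⟨D₁, hD₁⟩ := Filter.eventually_atTop.mp (eventually_mul_ell_pow_le K)
  refine ⟨max D₁ ⌈Real.exp (5 * |c'| * π + 3)⌉₊, fun D hD => ?_⟩
  have hK := hD₁ D (le_trans (le_max_left _ _) hD)
  obtain ⟨hℓ, hB⟩ := three_le_ell_and_Bsum_le (c' := c') (le_trans (le_max_right _ _) hD)
  have hℓ1 : 1 ≤ ell D := by linarith
  have hlogD : 3 ≤ Real.log D := hℓ
  have hDT : (D : ℝ) ≤ bigT D := by
    rw [Sec12D.natCast_eq_exp_ell (by linarith), bigT, Real.exp_le_exp]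
    calc ell D = ell D ^ (1 : ℝ) := (Real.rpow_one _).symm
      _ ≤ ell D ^ (1.1 : ℝ) := Real.rpow_le_rpow_of_exponent_le hℓ1 (by norm_num)
  have hT1 : 1 ≤ bigT D := by rw [bigT]; exact Real.one_le_exp (by positivity)
  have hP2 : P2pp D ≤ bigP D := by
    refine le_trans (Sec12D.P2pp_le_P_div_T_sq hlogD) ?_
    exact div_le_self (Real.exp_pos _).le (one_le_pow₀ hT1)
  exact ⟨hℓ, hB, hK, hDT, hP2⟩


/-! ### Three pieces of the main estimate, isolated -/

/-- **The tail terms beyond the truncation point.** With `Λ ≥ 16`, `1 ≤ X₁ ≤ X₂`, `X₂² ≤ N₀`,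
`e² ≤ N₀`, `‖a(n)‖ ≤ A·n` and `Re s ≥ 1 − α` (`0 ≤ α ≤ 1`): for `n > N₀`,
`‖a(n) n^{−s}(g(X₂/n) − g(X₁/n))‖ ≤ A·N₀⁻¹·n⁻²` ((4.3): `g(Xᵢ/n) ≤ ½e^{−Λ log²(n/Xᵢ)} ≤ ½n⁻⁴`,
since `log(n/Xᵢ) ≥ ½ log n ≥ 1`). [cite: Zhang2022LandauSiegel, §4 (4.3)] -/
private theorem tail_term_bound {Λ X₁ X₂ A α : ℝ} {N₀ : ℕ} (hΛ : 16 ≤ Λ) (hX₁0 : 0 < X₁)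
    (hX₁1 : 1 ≤ X₁) (hX₁₂ : X₁ ≤ X₂) (hX₂N : X₂ ^ 2 ≤ N₀) (hX₂N' : X₂ ≤ N₀)
    (he2 : Real.exp 2 ≤ N₀) (hN₀1 : 1 ≤ (N₀ : ℝ)) (hA : 0 ≤ A) (hα1 : α ≤ 1) {s : ℂ}
    (hs : 1 - α ≤ s.re) {a : ℕ → ℂ} (ha : ∀ n : ℕ, 1 ≤ n → ‖a n‖ ≤ A * n) {n : ℕ} (hn : N₀ < n) :
    ‖a n / (n : ℂ) ^ s * ((gWeight Λ (X₂ / n) : ℂ) - (gWeight Λ (X₁ / n) : ℂ))‖ ≤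
      A * (N₀ : ℝ)⁻¹ * (1 / (n : ℝ) ^ 2) := by
  have hX₂0 : 0 < X₂ := lt_of_lt_of_le hX₁0 hX₁₂
  have hX₂1 : 1 ≤ X₂ := le_trans hX₁1 hX₁₂
  have hnNr : (N₀ : ℝ) ≤ n := by exact_mod_cast hn.le
  have hnpos : 0 < n := lt_of_le_of_lt (Nat.zero_le _) hn
  have hn0' : (0 : ℝ) < n := by exact_mod_cast hnpos
  have hn1 : (1 : ℝ) ≤ n := by exact_mod_cast hnpos
  have hΛ0 : 0 < Λ := by linarith
  rw [norm_mul]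
  -- size of `a n / n^s`
  have h1 : ‖a n / (n : ℂ) ^ s‖ ≤ A * (n : ℝ) ^ α := by
    rw [norm_div, Complex.norm_natCast_cpow_of_pos hnpos, div_le_iff₀ (Real.rpow_pos_of_pos hn0' _)]
    have h2 : (n : ℝ) ≤ (n : ℝ) ^ α * (n : ℝ) ^ s.re := by
      rw [← Real.rpow_add hn0']
      calc (n : ℝ) = (n : ℝ) ^ (1 : ℝ) := (Real.rpow_one _).symm
        _ ≤ (n : ℝ) ^ (α + s.re) := Real.rpow_le_rpow_of_exponent_le hn1 (by linarith)
    calc ‖a n‖ ≤ A * n := ha n hnpos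
      _ ≤ A * ((n : ℝ) ^ α * (n : ℝ) ^ s.re) := mul_le_mul_of_nonneg_left h2 hA
      _ = A * (n : ℝ) ^ α * (n : ℝ) ^ s.re := by ring
  -- the weights
  have hnX₂sq : X₂ ^ 2 ≤ n := le_trans hX₂N hnNr
  have hlogn : 2 * Real.log X₂ ≤ Real.log n := by
    rw [← Real.log_rpow hX₂0, show ((2 : ℝ)) = ((2 : ℕ) : ℝ) by norm_num, Real.rpow_natCast]
    exact Real.log_le_log (by positivity) hnX₂sq
  have hlogX₁₂ : Real.log X₁ ≤ Real.log X₂ := Real.log_le_log hX₁0 hX₁₂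
  have hlogn2 : 2 ≤ Real.log n := by
    rw [Real.le_log_iff_exp_le hn0']; exact le_trans he2 hnNr
  have hgauss : ∀ X : ℝ, 0 < X → 1 ≤ X → Real.log X ≤ Real.log X₂ → X ≤ n →
      ‖(gWeight Λ (X / n) : ℂ)‖ ≤ (1 / 2) * (n : ℝ) ^ (-(4 : ℝ)) := by
    intro X hX0 hX1' hlogX hXn
    have hq : 0 < X / n := div_pos hX0 hn0'
    have hq1 : X / n ≤ 1 := (div_le_one hn0').mpr hXn
    rw [Complex.norm_real, Real.norm_eq_abs, abs_of_pos (gWeight_pos hΛ0 _)]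
    refine le_trans (gWeight_le hΛ0 hq hq1) ?_
    refine mul_le_mul_of_nonneg_left ?_ (by norm_num)
    refine le_trans ?_ (exp_neg_mul_log_sq_le hΛ hn0' (by linarith))
    rw [Real.exp_le_exp, Real.log_div hX0.ne' hn0'.ne']
    have hlX : 0 ≤ Real.log X := Real.log_nonneg hX1'
    have hd : Real.log n / 2 ≤ Real.log n - Real.log X := by linarith
    have hsq : (Real.log n / 2) ^ 2 ≤ (Real.log X - Real.log n) ^ 2 := by
      have : (Real.log X - Real.log n) ^ 2 = (Real.log n - Real.log X) ^ 2 := by ring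
      rw [this]; exact pow_le_pow_left₀ (by linarith) hd 2
    nlinarith
  have hg₂n := hgauss X₂ hX₂0 hX₂1 le_rfl (le_trans hX₂N' hnNr)
  have hg₁n := hgauss X₁ hX₁0 hX₁1 hlogX₁₂ (le_trans (le_trans hX₁₂ hX₂N') hnNr)
  have hW : ‖(gWeight Λ (X₂ / n) : ℂ) - (gWeight Λ (X₁ / n) : ℂ)‖ ≤ (n : ℝ) ^ (-(4 : ℝ)) := by
    calc _ ≤ ‖(gWeight Λ (X₂ / n) : ℂ)‖ + ‖(gWeight Λ (X₁ / n) : ℂ)‖ := norm_sub_le _ _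
      _ ≤ (1 / 2) * (n : ℝ) ^ (-(4 : ℝ)) + (1 / 2) * (n : ℝ) ^ (-(4 : ℝ)) := add_le_add hg₂n hg₁n
      _ = (n : ℝ) ^ (-(4 : ℝ)) := by ring
  -- combine: `A n^α · n^{−4} ≤ A N₀⁻¹ n⁻²`
  have hpow : (n : ℝ) ^ α * (n : ℝ) ^ (-(4 : ℝ)) ≤ (N₀ : ℝ)⁻¹ * (1 / (n : ℝ) ^ 2) := by
    rw [← Real.rpow_add hn0', show α + -(4 : ℝ) = (α - 2) + (-(2 : ℝ)) by ring, Real.rpow_add hn0']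
    have h3 : (n : ℝ) ^ (α - 2) ≤ (N₀ : ℝ)⁻¹ := by
      calc (n : ℝ) ^ (α - 2) ≤ (N₀ : ℝ) ^ (α - 2) :=
            Real.rpow_le_rpow_of_nonpos (by linarith) hnNr (by linarith)
        _ ≤ (N₀ : ℝ) ^ (-(1 : ℝ)) := Real.rpow_le_rpow_of_exponent_le hN₀1 (by linarith)
        _ = (N₀ : ℝ)⁻¹ := Real.rpow_neg_one _
    have h4 : (n : ℝ) ^ (-(2 : ℝ)) = 1 / (n : ℝ) ^ 2 := by
      rw [Real.rpow_neg hn0'.le, show (2 : ℝ) = ((2 : ℕ) : ℝ) by norm_num, Real.rpow_natCast,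
        one_div]
    rw [h4]
    exact mul_le_mul_of_nonneg_right h3 (by positivity)
  calc ‖a n / (n : ℂ) ^ s‖ * ‖(gWeight Λ (X₂ / n) : ℂ) - (gWeight Λ (X₁ / n) : ℂ)‖
      ≤ (A * (n : ℝ) ^ α) * (n : ℝ) ^ (-(4 : ℝ)) := mul_le_mul h1 hW (norm_nonneg _) (by positivity)
    _ = A * ((n : ℝ) ^ α * (n : ℝ) ^ (-(4 : ℝ))) := by ring
    _ ≤ A * ((N₀ : ℝ)⁻¹ * (1 / (n : ℝ) ^ 2)) := mul_le_mul_of_nonneg_left hpow hA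
    _ = A * (N₀ : ℝ)⁻¹ * (1 / (n : ℝ) ^ 2) := by ring

/-- **The short-interval hypothesis for the truncated majorant.** If
`Σ_{x<n≤x+y} F(n) ≤ C·e^{K log(4x)}·ρ·y` for `x ≥ x₀ ≥ 2`, `√x ≤ y ≤ x` (`K, ρ, C, E₀ ≥ 0`, `F ≥ 0`),
then `f = E₀·F·1[· ≤ N₀]` satisfies `Σ_{x<n≤x+y} f(n) ≤ (E₀ C e^{K log(4N₀)} ρ)·y·(log x)⁰`.
[cite: Zhang2022LandauSiegel, §4 (4.2)–(4.3)] -/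
private theorem shortInterval_trunc {F : ℕ → ℝ} (hF0 : ∀ n, 0 ≤ F n) {E₀ C K ρ x₀ : ℝ}
    (hE₀ : 0 ≤ E₀) (hC : 0 ≤ C) (hK : 0 ≤ K) (hρ : 0 ≤ ρ) (hx₀ : 2 ≤ x₀) {N₀ : ℕ}
    (hengine : ∀ x y : ℝ, x₀ ≤ x → Real.sqrt x ≤ y → y ≤ x →
      ∑ n ∈ Finset.Ioc ⌊x⌋₊ ⌊x + y⌋₊, F n ≤ C * Real.exp (K * Real.log (4 * x)) * ρ * y) :
    ∀ x y : ℝ, x₀ ≤ x → Real.sqrt x ≤ y → y ≤ x →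
      ∑ n ∈ Finset.Ioc ⌊x⌋₊ ⌊x + y⌋₊, (if n ≤ N₀ then E₀ * F n else 0) ≤
        (E₀ * C * Real.exp (K * Real.log (4 * (N₀ : ℝ))) * ρ) * y * Real.log x ^ (0 : ℕ) := by
  intro x y hx hy hyx
  rw [pow_zero, mul_one]
  have hx2 : 2 ≤ x := le_trans hx₀ hx
  have hy0 : 0 ≤ y := le_trans (Real.sqrt_nonneg x) hy
  by_cases hxN : N₀ ≤ ⌊x⌋₊
  · have hzero : ∀ n ∈ Finset.Ioc ⌊x⌋₊ ⌊x + y⌋₊, (if n ≤ N₀ then E₀ * F n else 0) = 0 := by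
      intro n hn
      have hn : N₀ < n := lt_of_le_of_lt hxN (Finset.mem_Ioc.mp hn).1
      rw [if_neg (not_le.mpr hn)]
    rw [Finset.sum_eq_zero hzero]; positivity
  · have hxN' : x ≤ N₀ := by
      have h1 : ⌊x⌋₊ + 1 ≤ N₀ := by omega
      have h2 : x < (⌊x⌋₊ : ℝ) + 1 := Nat.lt_floor_add_one x
      have h3 : ((⌊x⌋₊ + 1 : ℕ) : ℝ) ≤ N₀ := by exact_mod_cast h1
      push_cast at h3; linarith
    have hfle : ∀ n : ℕ, (if n ≤ N₀ then E₀ * F n else 0) ≤ E₀ * F n := by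
      intro n; split_ifs
      · exact le_rfl
      · exact mul_nonneg hE₀ (hF0 n)
    have heng := hengine x y hx hy hyx
    have hexp_le : Real.exp (K * Real.log (4 * x)) ≤ Real.exp (K * Real.log (4 * (N₀ : ℝ))) := by
      rw [Real.exp_le_exp]
      exact mul_le_mul_of_nonneg_left (Real.log_le_log (by linarith) (by linarith)) hK
    calc ∑ n ∈ Finset.Ioc ⌊x⌋₊ ⌊x + y⌋₊, (if n ≤ N₀ then E₀ * F n else 0)
        ≤ ∑ n ∈ Finset.Ioc ⌊x⌋₊ ⌊x + y⌋₊, E₀ * F n := Finset.sum_le_sum fun n _ => hfle n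
      _ = E₀ * ∑ n ∈ Finset.Ioc ⌊x⌋₊ ⌊x + y⌋₊, F n := by rw [Finset.mul_sum]
      _ ≤ E₀ * (C * Real.exp (K * Real.log (4 * x)) * ρ * y) := mul_le_mul_of_nonneg_left heng hE₀
      _ ≤ E₀ * (C * Real.exp (K * Real.log (4 * (N₀ : ℝ))) * ρ * y) := by gcongr
      _ = E₀ * C * Real.exp (K * Real.log (4 * (N₀ : ℝ))) * ρ * y := by ring

/-- **The initial segment of the truncated majorant**: if `F(n) ≤ A·n` (`n ≥ 1`, `A, E₀ ≥ 0`) then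
`Σ_{1≤n≤x₀} E₀F(n)1[n ≤ N₀] ≤ E₀·A·x₀²` (`x₀ ≥ 0`). [folklore] -/
private theorem initial_segment_trunc {F : ℕ → ℝ} {E₀ A x₀ : ℝ} (hE₀ : 0 ≤ E₀)
    (hA : 0 ≤ A) (hx₀ : 0 ≤ x₀) (hFA : ∀ n : ℕ, 1 ≤ n → F n ≤ A * n) {N₀ : ℕ} :
    ∑ n ∈ Finset.Icc 1 ⌊x₀⌋₊, (if n ≤ N₀ then E₀ * F n else 0) ≤ E₀ * A * x₀ ^ 2 := by
  have hterm : ∀ n ∈ Finset.Icc 1 ⌊x₀⌋₊, (if n ≤ N₀ then E₀ * F n else 0) ≤ E₀ * A * x₀ := by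
    intro n hn
    obtain ⟨hn1, hnx⟩ := Finset.mem_Icc.mp hn
    have hnx' : (n : ℝ) ≤ x₀ := (Nat.le_floor_iff hx₀).mp hnx
    have hFn : F n ≤ A * x₀ := le_trans (hFA n hn1) (mul_le_mul_of_nonneg_left hnx' hA)
    split_ifs
    · calc E₀ * F n ≤ E₀ * (A * x₀) := mul_le_mul_of_nonneg_left hFn hE₀
        _ = E₀ * A * x₀ := by ring
    · positivity
  calc ∑ n ∈ Finset.Icc 1 ⌊x₀⌋₊, (if n ≤ N₀ then E₀ * F n else 0)
      ≤ ∑ n ∈ Finset.Icc 1 ⌊x₀⌋₊, E₀ * A * x₀ := Finset.sum_le_sum hterm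
    _ = (⌊x₀⌋₊ : ℝ) * (E₀ * A * x₀) := by
        rw [Finset.sum_const, Nat.card_Icc, nsmul_eq_mul, Nat.add_sub_cancel]
    _ ≤ x₀ * (E₀ * A * x₀) := mul_le_mul_of_nonneg_right (Nat.floor_le hx₀) (by positivity)
    _ = E₀ * A * x₀ ^ 2 := by ring

/-- **The boundary term `l = X₁`.** The set `Ico ⌈X₁⌉ (⌊X₁⌋+1)` has at most one element `n`, with
`n = X₁`; if `‖b(n)‖ ≤ M√n` there, then `‖Σ b(n)/n‖ ≤ M/√X₁` (`X₁ > 0`, `M ≥ 0`). [folklore] -/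
private theorem boundary_bound {X₁ M : ℝ} (hX₁0 : 0 < X₁) (hM : 0 ≤ M) {b : ℕ → ℂ}
    (hb : ∀ n : ℕ, 0 < n → X₁ ≤ n → (n : ℝ) ≤ X₁ → ‖b n‖ ≤ M * Real.sqrt n) :
    ‖∑ n ∈ Finset.Ico ⌈X₁⌉₊ (⌊X₁⌋₊ + 1), b n / (n : ℂ)‖ ≤ M / Real.sqrt X₁ := by
  have hcard : (Finset.Ico ⌈X₁⌉₊ (⌊X₁⌋₊ + 1)).card ≤ 1 := by
    rw [Nat.card_Ico]; have := Nat.floor_le_ceil X₁; omega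
  have hterm : ∀ n ∈ Finset.Ico ⌈X₁⌉₊ (⌊X₁⌋₊ + 1), ‖b n / (n : ℂ)‖ ≤ M / Real.sqrt X₁ := by
    intro n hn
    obtain ⟨h1, h2⟩ := Finset.mem_Ico.mp hn
    have hnX : X₁ ≤ n := le_trans (Nat.le_ceil _) (by exact_mod_cast h1)
    have hnX' : (n : ℝ) ≤ X₁ := le_trans (by exact_mod_cast Nat.le_of_lt_succ h2) (Nat.floor_le hX₁0.le)
    have hn0' : (0 : ℝ) < n := lt_of_lt_of_le hX₁0 hnX
    have hnpos : 0 < n := by exact_mod_cast hn0'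
    have hsX : Real.sqrt X₁ = Real.sqrt n := by rw [le_antisymm hnX' hnX]
    have hsn0 : 0 < Real.sqrt (n : ℝ) := Real.sqrt_pos.mpr hn0'
    rw [norm_div, Complex.norm_natCast, div_le_iff₀ hn0', hsX]
    calc ‖b n‖ ≤ M * Real.sqrt n := hb n hnpos hnX hnX'
      _ = M / Real.sqrt n * n := by
          field_simp
          rw [Real.sq_sqrt hn0'.le]
  calc ‖∑ n ∈ Finset.Ico ⌈X₁⌉₊ (⌊X₁⌋₊ + 1), b n / (n : ℂ)‖
      ≤ ∑ n ∈ Finset.Ico ⌈X₁⌉₊ (⌊X₁⌋₊ + 1), ‖b n / (n : ℂ)‖ := norm_sum_le _ _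
    _ ≤ ∑ n ∈ Finset.Ico ⌈X₁⌉₊ (⌊X₁⌋₊ + 1), M / Real.sqrt X₁ := Finset.sum_le_sum hterm
    _ = ((Finset.Ico ⌈X₁⌉₊ (⌊X₁⌋₊ + 1)).card : ℝ) * (M / Real.sqrt X₁) := by
        rw [Finset.sum_const, nsmul_eq_mul]
    _ ≤ 1 * (M / Real.sqrt X₁) :=
        mul_le_mul_of_nonneg_right (by exact_mod_cast hcard) (div_nonneg hM (Real.sqrt_nonneg _))
    _ = M / Real.sqrt X₁ := one_mul _

/-- The final bookkeeping: two unsmoothing errors `≤ (27/2)SρL`, boundary and tail `≤ L`, `ρ ≥ 1`.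
[folklore] -/
private theorem final_arith {n₂ n₁ nb nt S ρ L : ℝ} (hρ : 1 ≤ ρ) (hL : 0 ≤ L)
    (h₂ : n₂ ≤ 27 / 2 * S * ρ * L) (h₁ : n₁ ≤ 27 / 2 * S * ρ * L) (hb : nb ≤ L) (ht : nt ≤ L) :
    n₂ + n₁ + nb + nt ≤ (27 * S + 2) * L * ρ := by
  have h1 : L ≤ L * ρ := le_mul_of_one_le_right hL hρ
  have h2 : (27 * S + 2) * L * ρ = 2 * (27 / 2 * S * ρ * L) + 2 * (L * ρ) := by ring
  rw [h2]; linarith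

/-! ### The main estimate -/

-- One long bookkeeping proof (≈ 300k heartbeats measured; 200k does not suffice): margin ×2–3.
set_option maxHeartbeats 800000 in
/-- **The `g`-unsmoothing of the window sum of §12.u024, relative form.** For every `c′` there is
`C ≥ 0` such that for all large `D`, every `χ (mod D)`, every `j`, all `d, r ≥ 1` with
`dr ≤ P″₁/T` and every `w` with `|w| = α`:
`‖Σ_{P″₁/dr<l<P″₂/dr} χ(l)ξ₀ⱼ(l;d,r)l^{−(1−β₆+w)} − Σ_l χ(l)ξ₀ⱼ(l;d,r)l^{−(1−β₆+w)}{g(P″₂/(drl)) −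
g(P″₁/(drl))}‖ ≤ C·𝓛⁻¹⁵·(r/φ(r))` ("by (4.2) and (4.3)", summed with the no-log-loss short-interval
mean of `ξ₀ⱼ`). [cite: Zhang2022LandauSiegel, §12 proof of Lemma 12.2, p. 69, tex L3528] -/
theorem norm_innerSum_sub_gSeries_le (c' : ℝ) : ∃ C : ℝ, 0 ≤ C ∧ ∃ D₀ : ℕ, ∀ (D : ℕ), D₀ ≤ D →
    ∀ (χ : DirichletCharacter ℂ D) (j d r : ℕ), 1 ≤ d → 1 ≤ r →
      ((d * r : ℕ) : ℝ) ≤ P1pp D / bigT D → ∀ w : ℂ, ‖w‖ = alpha D →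
        ‖innerSum c' χ j d r w - gSeries c' χ j d r w‖ ≤
          C * (ell D ^ 15)⁻¹ * ((r : ℝ) / r.totient) := by
  -- absolute constants: the short-interval engine and the divisor-class majorant
  obtain ⟨Ce, x₀, hCe, hx₀2, hengine⟩ := xiZero_shortInterval_Ioc
  obtain ⟨A₂, hA₂⟩ := ShiuDivisorClass.exists_rpow_majorant 3 1806
  -- `A₂ 1 ≥ 1`, `A₂ (1/2) ≥ 1` (test on `f = ‖ξ₀ⱼ(·;1,1)‖` at `n = 1`; we only need `≥ 0`)
  set E3 : ℝ := Real.exp (3 * π) with hE3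
  set Kbig : ℝ := max (Real.exp 2 * max x₀ 1) (max ((E3 * |A₂ (1 / 2)|) ^ 2) (2 * |A₂ 1|)) with hKbig
  obtain ⟨D₀, hD₀⟩ := sizes_eventually c' Kbig
  set Cfin : ℝ := 27 * (E3 * Ce * Real.exp (189 * π) + E3 * |A₂ 1| * x₀ ^ 2) + 2 with hCfin
  refine ⟨Cfin, by positivity, D₀, ?_⟩
  intro D hD χ j d r hd hr hdr w hw
  obtain ⟨hℓ, hBsum, hKD, hDT, hP2P⟩ := hD₀ D hD
  -- basic sizes
  have hℓ1 : 1 ≤ ell D := by linarith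
  have hℓ0 : 0 < ell D := by linarith
  have hlogD : 3 ≤ Real.log D := hℓ
  have hd0 : d ≠ 0 := by omega
  have hr0 : r ≠ 0 := by omega
  have hdr0 : 0 < ((d * r : ℕ) : ℝ) := by exact_mod_cast Nat.mul_pos (by omega) (by omega)
  have hdr1 : (1 : ℝ) ≤ ((d * r : ℕ) : ℝ) := by exact_mod_cast Nat.mul_pos (by omega) (by omega)
  have hα : alpha D = π / ell D ^ 9 := by rw [alpha, bigP, Real.log_exp]
  have hα0 : 0 < alpha D := by rw [hα]; positivity
  have hℓ9 : (3 : ℝ) ^ 9 ≤ ell D ^ 9 := pow_le_pow_left₀ (by norm_num) hℓ 9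
  have hαhalf : alpha D ≤ 1 / 2 := by
    rw [hα, div_le_iff₀ (by positivity)]
    have h39 : (3 : ℝ) ^ 9 = 19683 := by norm_num
    linarith [Real.pi_lt_four]
  have hP1 : 0 < P1pp D := Sec12D.P1pp_pos (by linarith)
  have hP2 : 0 < P2pp D := Sec12D.P2pp_pos (by linarith)
  have hT0 : 0 < bigT D := Real.exp_pos _
  have hKD' : Kbig * ell D ^ 30 ≤ bigT D := le_trans hKD hDT
  have hℓ30 : (1 : ℝ) ≤ ell D ^ 30 := one_le_pow₀ hℓ1
  have hK1 : Real.exp 2 * max x₀ 1 ≤ Kbig := le_max_left _ _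
  have hK2 : (E3 * |A₂ (1 / 2)|) ^ 2 ≤ Kbig := le_trans (le_max_left _ _) (le_max_right _ _)
  have hK3 : 2 * |A₂ 1| ≤ Kbig := le_trans (le_max_right _ _) (le_max_right _ _)
  have he2 : (1 : ℝ) ≤ Real.exp 2 := Real.one_le_exp (by norm_num)
  have hKbig0 : 0 ≤ Kbig := le_trans (by positivity) hK1
  have hKT : Kbig ≤ bigT D := le_trans (le_mul_of_one_le_right hKbig0 hℓ30) hKD'
  -- the cut points
  set X₁ : ℝ := P1pp D / ((d * r : ℕ) : ℝ) with hX₁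
  set X₂ : ℝ := P2pp D / ((d * r : ℕ) : ℝ) with hX₂
  have hX₁0 : 0 < X₁ := div_pos hP1 hdr0
  have hX₂0 : 0 < X₂ := div_pos hP2 hdr0
  have hTX₁ : bigT D ≤ X₁ := by
    rw [hX₁, le_div_iff₀ hdr0]
    calc bigT D * ((d * r : ℕ) : ℝ) ≤ bigT D * (P1pp D / bigT D) :=
          mul_le_mul_of_nonneg_left hdr hT0.le
      _ = P1pp D := by field_simp
  have hX₁₂ : X₁ ≤ X₂ := by
    rw [hX₁, hX₂]
    refine div_le_div_of_nonneg_right ?_ hdr0.le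
    rw [P1pp, P2pp]
    have : bigP D ^ (0.496 : ℝ) ≤ bigP D ^ (0.5 : ℝ) :=
      Real.rpow_le_rpow_of_exponent_le (by rw [bigP]; exact Real.one_le_exp (by positivity))
        (by norm_num)
    have ht0 : 0 < t0 D := by rw [t0]; positivity
    have hD0' : (0 : ℝ) < D := Sec12D.natCast_pos_of_one_le_log (by linarith)
    gcongr
  have hX₂P : X₂ ≤ bigP D := le_trans (div_le_self hP2.le hdr1) hP2P
  have hX₂PP : X₂ ≤ P2pp D := div_le_self hP2.le hdr1
  have hKX₁ : Kbig ≤ X₁ := le_trans hKT hTX₁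
  have hX₁1 : 1 ≤ X₁ := le_trans (le_trans (le_trans (le_max_right _ _)
    (le_mul_of_one_le_left (by positivity) he2)) hK1) hKX₁
  have hX₂1 : 1 ≤ X₂ := le_trans hX₁1 hX₁₂
  -- the truncation point `N₀ = ⌈X₂²⌉`
  set N₀ : ℕ := ⌈X₂ ^ 2⌉₊ with hN₀
  have hX₂N : X₂ ≤ N₀ := by
    calc X₂ ≤ X₂ ^ 2 := by nlinarith
      _ ≤ N₀ := Nat.le_ceil _
  have hN₀1 : (1 : ℝ) ≤ N₀ := le_trans hX₂1 hX₂N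
  have hN₀pos : 0 < N₀ := by exact_mod_cast (show (0 : ℝ) < N₀ by linarith)
  have hlogN : Real.log (4 * (N₀ : ℝ)) ≤ 3 * ell D ^ 9 := log_four_ceil_sq_le hℓ hX₂1 hX₂P
  -- `E₀ = N₀^α ≤ e^{3π}`
  set E₀ : ℝ := (N₀ : ℝ) ^ alpha D with hE₀
  have hE₀1 : 1 ≤ E₀ := Real.one_le_rpow hN₀1 hα0.le
  have hE₀le : E₀ ≤ E3 := by
    rw [hE₀, hE3, Real.rpow_def_of_pos (by linarith), Real.exp_le_exp]
    have hlogN' : Real.log N₀ ≤ 3 * ell D ^ 9 := by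
      refine le_trans (Real.log_le_log (by linarith) ?_) hlogN; linarith
    have hlog0 : 0 ≤ Real.log (N₀ : ℝ) := Real.log_nonneg hN₀1
    calc Real.log N₀ * alpha D ≤ 3 * ell D ^ 9 * alpha D :=
          mul_le_mul_of_nonneg_right hlogN' hα0.le
      _ = 3 * π := by rw [hα]; field_simp
  -- `exp(7B log(4N₀)) ≤ e^{189π}`
  have hexpB : Real.exp (7 * Bsum c' D * Real.log (4 * (N₀ : ℝ))) ≤ Real.exp (189 * π) := by
    rw [Real.exp_le_exp]
    have hB0 : 0 ≤ Bsum c' D := Bsum_nonneg c' D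
    calc 7 * Bsum c' D * Real.log (4 * (N₀ : ℝ)) ≤ 7 * Bsum c' D * (3 * ell D ^ 9) :=
          mul_le_mul_of_nonneg_left hlogN (by positivity)
      _ ≤ 7 * (9 * π / ell D ^ 9) * (3 * ell D ^ 9) := by gcongr
      _ = 189 * π := by field_simp; ring
  -- the data: `s`, `a`, `b`, `F`, `f`
  set s : ℂ := 1 - beta6 D + w with hs
  have hβ6 : (beta6 D).re = 0 := by simp [beta6]
  have hsre : s.re = 1 + w.re := by rw [hs]; simp [hβ6]
  have hwre : |w.re| ≤ alpha D := by rw [← hw]; exact Complex.abs_re_le_norm w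
  set a : ℕ → ℂ := fun n => χ (n : ZMod D) * xiZero c' D j n d r with ha
  set F : ℕ → ℝ := fun n => ‖xiZero c' D j n d r‖ with hF
  set b : ℕ → ℂ := fun n => if n ≤ N₀ then a n * (n : ℂ) ^ (1 - s) else 0 with hb
  set f : ℕ → ℝ := fun n => if n ≤ N₀ then E₀ * F n else 0 with hf
  have hF0 : ∀ n, 0 ≤ F n := fun n => norm_nonneg _
  have hf0 : ∀ n, 0 ≤ f n := by
    intro n; simp only [hf]; split_ifs
    · exact mul_nonneg (by linarith) (hF0 n)
    · exact le_rfl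
  have haF : ∀ n, ‖a n‖ ≤ F n := by
    intro n
    simp only [ha, hF, norm_mul]
    exact mul_le_of_le_one_left (norm_nonneg _) (χ.norm_le_one _)
  -- multiplicativity and the prime-power bound of `F`, its rpow majorants
  have hFmul : ∀ m n : ℕ, m.Coprime n → F (m * n) = F m * F n := by
    intro m n hmn; simp only [hF]; rw [Lemma83.xiZero_mul_of_coprime c' D j hd0 hr0 hmn, norm_mul]
  have hFpow : ∀ p ν : ℕ, p.Prime → 1 ≤ ν → F (p ^ ν) ≤ 1806 * ((ν : ℝ) + 1) ^ 3 :=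
    fun p ν hp hν => Lemma83.norm_xiZero_prime_pow_le c' D j hp (Nat.one_le_iff_ne_zero.mp hν) d r
  have hFmaj : ∀ δ : ℝ, 0 < δ → ∀ n : ℕ, 1 ≤ n → F n ≤ A₂ δ * (n : ℝ) ^ δ :=
    fun δ hδ n hn => hA₂ F hF0 hFmul hFpow δ hδ n hn
  have hA1 : 0 ≤ A₂ 1 := by
    have h := hFmaj 1 one_pos 1 le_rfl
    simp only [hF, Nat.cast_one, Real.one_rpow, mul_one, Lemma83.xiZero_apply_one, norm_one] at h
    linarith
  have hAh : 0 ≤ A₂ (1 / 2) := by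
    have h := hFmaj (1 / 2) (by norm_num) 1 le_rfl
    simp only [hF, Nat.cast_one, Real.one_rpow, mul_one, Lemma83.xiZero_apply_one, norm_one] at h
    linarith
  -- the norm of `n^{1−s}` and the majorant `‖b n‖ ≤ f n`
  have hnorm_cpow : ∀ n : ℕ, 1 ≤ n → n ≤ N₀ → ‖(n : ℂ) ^ (1 - s)‖ ≤ E₀ := by
    intro n hn hnN
    have hn0 : 0 < n := hn
    have hn1 : (1 : ℝ) ≤ n := by exact_mod_cast hn
    rw [Complex.norm_natCast_cpow_of_pos hn0, show (1 - s).re = -w.re by rw [sub_re, hsre]; simp]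
    calc (n : ℝ) ^ (-w.re) ≤ (n : ℝ) ^ alpha D :=
          Real.rpow_le_rpow_of_exponent_le hn1 (by linarith [neg_abs_le w.re, hwre])
      _ ≤ (N₀ : ℝ) ^ alpha D :=
          Real.rpow_le_rpow (by positivity) (by exact_mod_cast hnN) hα0.le
  have hbf : ∀ n : ℕ, 1 ≤ n → ‖b n‖ ≤ f n := by
    intro n hn
    simp only [hb, hf]
    split_ifs with hnN
    · rw [norm_mul]
      calc ‖a n‖ * ‖(n : ℂ) ^ (1 - s)‖ ≤ F n * E₀ :=
            mul_le_mul (haF n) (hnorm_cpow n hn hnN) (norm_nonneg _) (hF0 n)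
        _ = E₀ * F n := mul_comm _ _
    · simp
  -- the short-interval hypothesis for `f` (exponent `k = 0`) and the initial segment
  have hrφ1 : 1 ≤ (r : ℝ) / r.totient := Skeleton.one_le_self_div_totient hr0
  have hrφ0 : 0 ≤ (r : ℝ) / r.totient := le_trans zero_le_one hrφ1
  have hE₀0 : 0 ≤ E₀ := by linarith
  set Bf : ℝ := E₀ * Ce * Real.exp (7 * Bsum c' D * Real.log (4 * (N₀ : ℝ))) *
    ((r : ℝ) / r.totient) with hBf
  have hBf0 : 0 ≤ Bf := by positivity
  have hx₀1 : 1 ≤ x₀ := by linarith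
  have hShort : ∀ x y : ℝ, x₀ ≤ x → Real.sqrt x ≤ y → y ≤ x →
      ∑ n ∈ Finset.Ioc ⌊x⌋₊ ⌊x + y⌋₊, f n ≤ Bf * y * Real.log x ^ (0 : ℕ) :=
    shortInterval_trunc hF0 hE₀0 hCe (mul_nonneg (by norm_num) (Bsum_nonneg c' D)) hrφ0 hx₀2
      (fun x y hx hy hyx => hengine c' D j d r hd0 hr0 x y hx hy hyx)
  -- the initial segment
  set F₀ : ℝ := E₀ * |A₂ 1| * x₀ ^ 2 with hF₀
  have hF₀0 : 0 ≤ F₀ := by positivity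
  have hFA : ∀ n : ℕ, 1 ≤ n → F n ≤ |A₂ 1| * n := by
    intro n hn
    calc F n ≤ A₂ 1 * (n : ℝ) ^ (1 : ℝ) := hFmaj 1 one_pos n hn
      _ = A₂ 1 * n := by rw [Real.rpow_one]
      _ ≤ |A₂ 1| * n := mul_le_mul_of_nonneg_right (le_abs_self _) (Nat.cast_nonneg n)
  have hSmall : ∑ n ∈ Finset.Icc 1 ⌊x₀⌋₊, f n ≤ F₀ :=
    initial_segment_trunc hE₀0 (abs_nonneg _) (by linarith) hFA
  -- the two applications of the unsmoothing theorem
  have hΛ4 : (4 : ℝ) ≤ ell D ^ 30 := le_trans (by norm_num) (pow_le_pow_left₀ (by norm_num) hℓ 30)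
  have hΛ16 : (16 : ℝ) ≤ ell D ^ 30 := le_trans (by norm_num) (pow_le_pow_left₀ (by norm_num) hℓ 30)
  have hΛk : ((0 : ℕ) : ℝ) + 1 ≤ 2 * ell D ^ 30 := by push_cast; linarith
  have hKe2 : Real.exp 2 ≤ Kbig :=
    le_trans (le_mul_of_one_le_right (by positivity) (le_max_right _ _)) hK1
  have hXx₀ : ∀ X, X₁ ≤ X → Real.exp 2 * x₀ ≤ X := fun X hX =>
    le_trans (le_trans (le_trans (mul_le_mul_of_nonneg_left (le_max_left _ _) (by positivity))
      hK1) hKX₁) hX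
  have hXΛ : ∀ X, X₁ ≤ X → Real.exp 2 * ell D ^ 30 ≤ X := fun X hX =>
    le_trans (le_trans (le_trans (mul_le_mul_of_nonneg_right hKe2 (by positivity)) hKD') hTX₁) hX
  obtain ⟨hsum₂, hmain₂⟩ := norm_sum_Ico_sub_tsum_mul_gWeight_le_of_shortInterval (a := b) hf0 hbf
    hBf0 hx₀1 hShort hSmall hF₀0 hΛ4 hΛk (hXx₀ X₂ hX₁₂) (hXΛ X₂ hX₁₂)
  obtain ⟨hsum₁, hmain₁⟩ := norm_sum_Ico_sub_tsum_mul_gWeight_le_of_shortInterval (a := b) hf0 hbf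
    hBf0 hx₀1 hShort hSmall hF₀0 hΛ4 hΛk (hXx₀ X₁ le_rfl) (hXΛ X₁ le_rfl)
  -- strict ordering of the cut points and the integer bookkeeping
  have hX₁₂' : X₁ < X₂ := by
    rw [hX₁, hX₂]
    refine div_lt_div_of_pos_right ?_ hdr0
    rw [P1pp, P2pp]
    have hP1 : 1 < bigP D := by rw [bigP]; exact Real.one_lt_exp_iff.mpr (by positivity)
    have : bigP D ^ (0.496 : ℝ) < bigP D ^ (0.5 : ℝ) :=
      Real.rpow_lt_rpow_of_exponent_lt hP1 (by norm_num)
    have ht0 : 0 < t0 D := by rw [t0]; positivity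
    have hD0' : (0 : ℝ) < D := Sec12D.natCast_pos_of_one_le_log (by linarith)
    gcongr
  have hceil₁ : 1 ≤ ⌈X₁⌉₊ := Nat.one_le_iff_ne_zero.mpr (Nat.ceil_pos.mpr hX₁0).ne'
  have hceil₁₂ : ⌈X₁⌉₊ ≤ ⌈X₂⌉₊ := Nat.ceil_mono hX₁₂
  have hcf : ⌈X₁⌉₊ ≤ ⌊X₁⌋₊ + 1 := Nat.ceil_le_floor_add_one X₁
  have hfc : ⌊X₁⌋₊ + 1 ≤ ⌈X₂⌉₊ :=
    Nat.succ_le_of_lt (Nat.lt_ceil.mpr (lt_of_le_of_lt (Nat.floor_le hX₁0.le) hX₁₂'))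
  -- the sharp window sum in terms of `b`
  have hinner : innerSum c' χ j d r w = ∑ n ∈ Finset.Ico (⌊X₁⌋₊ + 1) ⌈X₂⌉₊, b n / (n : ℂ) := by
    unfold innerSum
    have hset : (Finset.Ico 1 ⌈P2pp D⌉₊).filter (fun l : ℕ =>
        P1pp D / ((d * r : ℕ) : ℝ) < l ∧ (l : ℝ) < P2pp D / ((d * r : ℕ) : ℝ)) =
        Finset.Ico (⌊X₁⌋₊ + 1) ⌈X₂⌉₊ := by
      ext l
      simp only [Finset.mem_filter, Finset.mem_Ico]
      constructor
      · rintro ⟨-, h3, h4⟩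
        exact ⟨Nat.succ_le_of_lt ((Nat.floor_lt hX₁0.le).mpr h3), Nat.lt_ceil.mpr h4⟩
      · rintro ⟨h1, h2⟩
        have h3 : X₁ < l := (Nat.floor_lt hX₁0.le).mp (Nat.lt_of_succ_le h1)
        have h4 : (l : ℝ) < X₂ := Nat.lt_ceil.mp h2
        exact ⟨⟨by omega, Nat.lt_ceil.mpr (lt_of_lt_of_le h4 hX₂PP)⟩, h3, h4⟩
    rw [hset]
    refine Finset.sum_congr rfl fun l hl => ?_
    obtain ⟨h1, h2⟩ := Finset.mem_Ico.mp hl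
    have hl0 : l ≠ 0 := by omega
    have hlN : l ≤ N₀ := by
      have h4 : (l : ℝ) < X₂ := Nat.lt_ceil.mp h2
      exact_mod_cast (show (l : ℝ) ≤ N₀ by linarith)
    simp only [hb, if_pos hlN, ha]
    rw [mul_cpow_one_sub_div _ _ hl0, hs]
  have hI1 := Finset.sum_Ico_consecutive (fun n => b n / (n : ℂ)) hcf hfc
  have hI2 := Finset.sum_Ico_consecutive (fun n => b n / (n : ℂ)) hceil₁ hceil₁₂
  have hsharp : innerSum c' χ j d r w =
      (∑ n ∈ Finset.Ico 1 ⌈X₂⌉₊, b n / (n : ℂ)) - (∑ n ∈ Finset.Ico 1 ⌈X₁⌉₊, b n / (n : ℂ)) -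
        ∑ n ∈ Finset.Ico ⌈X₁⌉₊ (⌊X₁⌋₊ + 1), b n / (n : ℂ) := by
    rw [hinner]; linear_combination hI1 + hI2
  -- the smoothed series: `gSeries = (T₂ − T₁) + tail`
  set g₂ : ℕ → ℂ := fun n => (gWeight (ell D ^ 30) (X₂ / n) : ℂ) with hg₂
  set g₁ : ℕ → ℂ := fun n => (gWeight (ell D ^ 30) (X₁ / n) : ℂ) with hg₁
  set cfun : ℕ → ℂ := fun n => LSeries.term a s n * (g₂ n - g₁ n) -
    (b n / (n : ℂ) * g₂ n - b n / (n : ℂ) * g₁ n) with hcfun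
  have hgS : gSeries c' χ j d r w = ∑' n : ℕ, LSeries.term a s n * (g₂ n - g₁ n) := by
    unfold gSeries
    exact tsum_congr (fun l => gSeries_summand_eq j d r w l)
  have hdecomp : (fun n : ℕ => LSeries.term a s n * (g₂ n - g₁ n)) =
      fun n => (b n / (n : ℂ) * g₂ n - b n / (n : ℂ) * g₁ n) + cfun n := by
    funext n; simp only [hcfun]; ring
  have hsumUV : Summable (fun n : ℕ => b n / (n : ℂ) * g₂ n - b n / (n : ℂ) * g₁ n) :=
    hsum₂.sub hsum₁
  -- pointwise bound for the tail terms `n > N₀`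
  have haA : ∀ n : ℕ, 1 ≤ n → ‖a n‖ ≤ |A₂ 1| * n := fun n hn => le_trans (haF n) (hFA n hn)
  have hsα : 1 - alpha D ≤ s.re := by rw [hsre]; linarith [abs_le.mp hwre]
  have he2N : Real.exp 2 ≤ N₀ := le_trans (le_trans hKe2 hKX₁) (le_trans hX₁₂ hX₂N)
  have hX₂sqN : X₂ ^ 2 ≤ N₀ := Nat.le_ceil _
  have hc_bound : ∀ n : ℕ, ‖cfun n‖ ≤ |A₂ 1| * (N₀ : ℝ)⁻¹ * (1 / (n : ℝ) ^ 2) := by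
    intro n
    rcases Nat.eq_zero_or_pos n with rfl | hnpos
    · simp [hcfun]
    by_cases hnN : n ≤ N₀
    · have hzero : cfun n = 0 := by
        simp only [hcfun, hb, if_pos hnN, LSeries.term_of_ne_zero hnpos.ne']
        rw [mul_cpow_one_sub_div _ _ hnpos.ne']; ring
      rw [hzero, norm_zero]; positivity
    · have hnN' : N₀ < n := not_le.mp hnN
      have hcn : cfun n = a n / (n : ℂ) ^ s * (g₂ n - g₁ n) := by
        simp only [hcfun, hb, if_neg hnN, LSeries.term_of_ne_zero hnpos.ne', zero_div, zero_mul,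
          sub_zero]
      rw [hcn]
      exact tail_term_bound hΛ16 hX₁0 hX₁1 hX₁₂ hX₂sqN hX₂N he2N hN₀1 (abs_nonneg _)
        (by linarith) hsα haA hnN'
  have hmaj_summ : Summable (fun n : ℕ => |A₂ 1| * (N₀ : ℝ)⁻¹ * (1 / (n : ℝ) ^ 2)) :=
    (Real.summable_one_div_nat_pow.mpr one_lt_two).mul_left _
  have hc_summ : Summable cfun := Summable.of_norm_bounded hmaj_summ hc_bound
  have htail : ‖∑' n : ℕ, cfun n‖ ≤ 2 * |A₂ 1| * (N₀ : ℝ)⁻¹ := by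
    calc ‖∑' n : ℕ, cfun n‖ ≤ ∑' n : ℕ, ‖cfun n‖ := norm_tsum_le_tsum_norm hc_summ.norm
      _ ≤ ∑' n : ℕ, |A₂ 1| * (N₀ : ℝ)⁻¹ * (1 / (n : ℝ) ^ 2) :=
          Summable.tsum_le_tsum hc_bound hc_summ.norm hmaj_summ
      _ = |A₂ 1| * (N₀ : ℝ)⁻¹ * ∑' n : ℕ, (1 / (n : ℝ) ^ 2) := tsum_mul_left
      _ ≤ |A₂ 1| * (N₀ : ℝ)⁻¹ * 2 := mul_le_mul_of_nonneg_left tsum_one_div_nat_sq_le_two (by positivity)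
      _ = 2 * |A₂ 1| * (N₀ : ℝ)⁻¹ := by ring
  have hsmooth : gSeries c' χ j d r w =
      ((∑' n : ℕ, b n / (n : ℂ) * g₂ n) - ∑' n : ℕ, b n / (n : ℂ) * g₁ n) + ∑' n : ℕ, cfun n := by
    rw [hgS, hdecomp, hsumUV.tsum_add hc_summ, hsum₂.tsum_sub hsum₁]
  -- the possible boundary term `l = X₁ ∈ ℕ`
  have hbterm : ∀ n : ℕ, 0 < n → X₁ ≤ n → (n : ℝ) ≤ X₁ →
      ‖b n‖ ≤ E3 * |A₂ (1 / 2)| * Real.sqrt n := by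
    intro n hnpos hnX hnX'
    have hfn : f n ≤ E₀ * F n := by
      simp only [hf]; split_ifs
      · exact le_rfl
      · exact mul_nonneg hE₀0 (hF0 n)
    have hFn : F n ≤ |A₂ (1 / 2)| * Real.sqrt n := by
      calc F n ≤ A₂ (1 / 2) * (n : ℝ) ^ (1 / 2 : ℝ) := hFmaj (1 / 2) (by norm_num) n hnpos
        _ = A₂ (1 / 2) * Real.sqrt n := by rw [Real.sqrt_eq_rpow]
        _ ≤ |A₂ (1 / 2)| * Real.sqrt n :=
            mul_le_mul_of_nonneg_right (le_abs_self _) (Real.sqrt_nonneg _)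
    calc ‖b n‖ ≤ f n := hbf n hnpos
      _ ≤ E₀ * F n := hfn
      _ ≤ E3 * (|A₂ (1 / 2)| * Real.sqrt n) := mul_le_mul hE₀le hFn (hF0 n) (by positivity)
      _ = E3 * |A₂ (1 / 2)| * Real.sqrt n := by ring
  have hkey : E3 * |A₂ (1 / 2)| / Real.sqrt X₁ ≤ (ell D ^ 15)⁻¹ := by
    have hsX0 : 0 < Real.sqrt X₁ := Real.sqrt_pos.mpr hX₁0
    rw [div_le_iff₀ hsX0, ← one_div, one_div_mul_eq_div, le_div_iff₀ (by positivity)]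
    have h1 : (E3 * |A₂ (1 / 2)|) ^ 2 * ell D ^ 30 ≤ X₁ :=
      le_trans (le_trans (mul_le_mul_of_nonneg_right hK2 (by positivity)) hKD') hTX₁
    have h2 : (E3 * |A₂ (1 / 2)| * ell D ^ 15) ^ 2 ≤ X₁ := by
      calc (E3 * |A₂ (1 / 2)| * ell D ^ 15) ^ 2 = (E3 * |A₂ (1 / 2)|) ^ 2 * ell D ^ 30 := by ring
        _ ≤ X₁ := h1
    have hx : 0 ≤ E3 * |A₂ (1 / 2)| * ell D ^ 15 := by positivity
    exact (Real.le_sqrt hx hX₁0.le).mpr h2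
  have hbdry : ‖∑ n ∈ Finset.Ico ⌈X₁⌉₊ (⌊X₁⌋₊ + 1), b n / (n : ℂ)‖ ≤ (ell D ^ 15)⁻¹ :=
    le_trans (boundary_bound hX₁0 (by positivity) hbterm) hkey
  -- the tail in terms of `𝓛⁻¹⁵`: `2|A₂ 1|/N₀ ≤ 𝓛⁻¹⁵` since `N₀ ≥ X₂ ≥ K𝓛³⁰ ≥ 2|A₂ 1|𝓛¹⁵`
  have htail' : 2 * |A₂ 1| * (N₀ : ℝ)⁻¹ ≤ (ell D ^ 15)⁻¹ := by
    have hN : 2 * |A₂ 1| * ell D ^ 15 ≤ N₀ := by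
      have h15 : ell D ^ 15 ≤ ell D ^ 30 := pow_le_pow_right₀ hℓ1 (by norm_num)
      calc 2 * |A₂ 1| * ell D ^ 15 ≤ Kbig * ell D ^ 30 := mul_le_mul hK3 h15 (by positivity) hKbig0
        _ ≤ N₀ := le_trans (le_trans hKD' hTX₁) (le_trans hX₁₂ hX₂N)
    rw [← div_eq_mul_inv, div_le_iff₀ (by positivity), ← one_div, one_div_mul_eq_div,
      le_div_iff₀ (by positivity)]
    linarith
  -- the two unsmoothing errors in terms of `𝓛⁻¹⁵`
  have hsqrt : Real.sqrt (ell D ^ 30) = ell D ^ 15 := by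
    rw [show ell D ^ 30 = (ell D ^ 15) ^ 2 by ring, Real.sqrt_sq (by positivity)]
  have hBF : Bf + F₀ ≤ (E3 * Ce * Real.exp (189 * π) + E3 * |A₂ 1| * x₀ ^ 2) *
      ((r : ℝ) / r.totient) := by
    have h1 : Bf ≤ E3 * Ce * Real.exp (189 * π) * ((r : ℝ) / r.totient) := by
      rw [hBf]; gcongr
    have h2 : F₀ ≤ E3 * |A₂ 1| * x₀ ^ 2 * ((r : ℝ) / r.totient) := by
      rw [hF₀]
      calc E₀ * |A₂ 1| * x₀ ^ 2 ≤ E3 * |A₂ 1| * x₀ ^ 2 := by gcongr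
        _ ≤ E3 * |A₂ 1| * x₀ ^ 2 * ((r : ℝ) / r.totient) :=
            le_mul_of_one_le_right (by positivity) hrφ1
    linarith
  have herr : ∀ X : ℝ, 3 ^ (0 + 3) * (Bf * Real.log X ^ (0 : ℕ) + F₀) / Real.sqrt (ell D ^ 30) / 2 ≤
      27 / 2 * (E3 * Ce * Real.exp (189 * π) + E3 * |A₂ 1| * x₀ ^ 2) *
        ((r : ℝ) / r.totient) * (ell D ^ 15)⁻¹ := by
    intro X
    rw [pow_zero, mul_one, hsqrt]
    rw [show (3 : ℝ) ^ (0 + 3) * (Bf + F₀) / ell D ^ 15 / 2 = 27 / 2 * (Bf + F₀) * (ell D ^ 15)⁻¹ by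
      norm_num; ring]
    have h15 : 0 ≤ (ell D ^ 15)⁻¹ := by positivity
    calc 27 / 2 * (Bf + F₀) * (ell D ^ 15)⁻¹
        ≤ 27 / 2 * ((E3 * Ce * Real.exp (189 * π) + E3 * |A₂ 1| * x₀ ^ 2) * ((r : ℝ) / r.totient)) *
          (ell D ^ 15)⁻¹ := by gcongr
      _ = _ := by ring
  -- assembly
  have hdiff : innerSum c' χ j d r w - gSeries c' χ j d r w =
      ((∑ n ∈ Finset.Ico 1 ⌈X₂⌉₊, b n / (n : ℂ)) - ∑' n : ℕ, b n / (n : ℂ) * g₂ n) -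
      ((∑ n ∈ Finset.Ico 1 ⌈X₁⌉₊, b n / (n : ℂ)) - ∑' n : ℕ, b n / (n : ℂ) * g₁ n) -
      (∑ n ∈ Finset.Ico ⌈X₁⌉₊ (⌊X₁⌋₊ + 1), b n / (n : ℂ)) - ∑' n : ℕ, cfun n := by
    rw [hsharp, hsmooth]; ring
  rw [hdiff]
  have hm₂ := le_trans hmain₂ (herr X₂)
  have hm₁ := le_trans hmain₁ (herr X₁)
  calc _ ≤ ‖(∑ n ∈ Finset.Ico 1 ⌈X₂⌉₊, b n / (n : ℂ)) - ∑' n : ℕ, b n / (n : ℂ) * g₂ n‖ +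
        ‖(∑ n ∈ Finset.Ico 1 ⌈X₁⌉₊, b n / (n : ℂ)) - ∑' n : ℕ, b n / (n : ℂ) * g₁ n‖ +
        ‖∑ n ∈ Finset.Ico ⌈X₁⌉₊ (⌊X₁⌋₊ + 1), b n / (n : ℂ)‖ + ‖∑' n : ℕ, cfun n‖ := by
        have e1 := norm_sub_le
          (((∑ n ∈ Finset.Ico 1 ⌈X₂⌉₊, b n / (n : ℂ)) - ∑' n : ℕ, b n / (n : ℂ) * g₂ n) -
            ((∑ n ∈ Finset.Ico 1 ⌈X₁⌉₊, b n / (n : ℂ)) - ∑' n : ℕ, b n / (n : ℂ) * g₁ n) -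
            (∑ n ∈ Finset.Ico ⌈X₁⌉₊ (⌊X₁⌋₊ + 1), b n / (n : ℂ))) (∑' n : ℕ, cfun n)
        have e2 := norm_sub_le
          (((∑ n ∈ Finset.Ico 1 ⌈X₂⌉₊, b n / (n : ℂ)) - ∑' n : ℕ, b n / (n : ℂ) * g₂ n) -
            ((∑ n ∈ Finset.Ico 1 ⌈X₁⌉₊, b n / (n : ℂ)) - ∑' n : ℕ, b n / (n : ℂ) * g₁ n))
          (∑ n ∈ Finset.Ico ⌈X₁⌉₊ (⌊X₁⌋₊ + 1), b n / (n : ℂ))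
        have e3 := norm_sub_le
          ((∑ n ∈ Finset.Ico 1 ⌈X₂⌉₊, b n / (n : ℂ)) - ∑' n : ℕ, b n / (n : ℂ) * g₂ n)
          ((∑ n ∈ Finset.Ico 1 ⌈X₁⌉₊, b n / (n : ℂ)) - ∑' n : ℕ, b n / (n : ℂ) * g₁ n)
        linarith
    _ ≤ 27 / 2 * (E3 * Ce * Real.exp (189 * π) + E3 * |A₂ 1| * x₀ ^ 2) *
          ((r : ℝ) / r.totient) * (ell D ^ 15)⁻¹ +
        27 / 2 * (E3 * Ce * Real.exp (189 * π) + E3 * |A₂ 1| * x₀ ^ 2) *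
          ((r : ℝ) / r.totient) * (ell D ^ 15)⁻¹ +
        (ell D ^ 15)⁻¹ + (ell D ^ 15)⁻¹ :=
        add_le_add (add_le_add (add_le_add hm₂ hm₁) hbdry) (le_trans htail htail')
    _ ≤ Cfin * (ell D ^ 15)⁻¹ * ((r : ℝ) / r.totient) := by
        rw [hCfin]
        exact final_arith (S := E3 * Ce * Real.exp (189 * π) + E3 * |A₂ 1| * x₀ ^ 2)
          (ρ := (r : ℝ) / r.totient) (L := (ell D ^ 15)⁻¹) hrφ1 (by positivity)
          le_rfl le_rfl le_rfl le_rfl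

/-- **`Z22:§12.u024` in the relative reading (`U024Rel`-shape).** For every `c′` there is `C` such that
for all large `D` (every quadratic primitive `χ (mod D)`, no Assumption (A) needed), every `j`, all
`d, r ≥ 1` with `dr ≤ P″₁/T` and every `w` with `|w| = α`, BOTH printed approximations hold with the
error `C·𝓛⁻¹⁵·(r/φ(r))`:
`‖innerSum − gSeries‖ ≤ C𝓛⁻¹⁵·r/φ(r)` and `‖innerSum − lineInt024‖ ≤ C𝓛⁻¹⁵·r/φ(r)`
(the second from the first by `gSeries = lineInt024`, `Typed.Sec12B.gSeries_eq_lineInt024`). The typed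
node `Typed.Sec12B.U024` asserts the same with a `(d,r)`-uniform constant; see the module docstring for
why the weight `r/φ(r)` is intrinsic to the method. [cite: Zhang2022LandauSiegel, §12 proof of Lemma 12.2, p. 69, tex L3528] -/
theorem u024Rel (c' : ℝ) : ∃ C : ℝ, ForAllLarge fun D _ χ =>
    ∀ j d r : ℕ, 1 ≤ d → 1 ≤ r → ((d * r : ℕ) : ℝ) ≤ P1pp D / bigT D → ∀ w : ℂ, ‖w‖ = alpha D →
      ‖innerSum c' χ j d r w - gSeries c' χ j d r w‖ ≤ C * (ell D ^ 15)⁻¹ * ((r : ℝ) / r.totient) ∧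
      ‖innerSum c' χ j d r w - lineInt024 c' χ j d r w‖ ≤
        C * (ell D ^ 15)⁻¹ * ((r : ℝ) / r.totient) := by
  obtain ⟨C, -, D₀, h⟩ := norm_innerSum_sub_gSeries_le c'
  refine ⟨C, max D₀ 9, fun D _ χ hD _ _ j d r hd hr hdr w hw => ?_⟩
  have hD9 : 9 ≤ D := le_trans (le_max_right _ _) hD
  have h1 := h D (le_trans (le_max_left _ _) hD) χ j d r hd hr hdr w hw
  refine ⟨h1, ?_⟩
  rw [norm_innerSum_sub_lineInt024_eq (le_trans (by norm_num) hD9) (by omega) (by omega) j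
    (neg_one_lt_re_of_norm_eq_alpha (alpha_lt_one hD9) hw)]
  exact h1

end Literature.NumberTheory.LFunctions.Zhang2022.Typed.Sec12B

end
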